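import Summits.BirchSwinnertonDyer.Rank1Residual.Supersingular.SprungChromaticNonvanishingEdges
import Literature.NumberTheory.EllipticCurves.Sprung2012.SharpFlatKatoDivisibility
import Literature.NumberTheory.EllipticCurves.Rank1Residual.Predicates
import HarnessLib

/-!
# Selmer-side kernel edges of the leaf `SprungChromaticNonvanishing` (Sprung 2012 Conj. 6.15, `η = 1`,
# odd `p`): «Conj. 6.15 ⇒ Conj. 7.15» (both `X♯`, `X♭` cotorsion) through Thm. 7.14, and the Kato
# inclusion of Thm. 7.16 for BOTH colours — PROVED bookkeeping, nothing asserted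
# (typing layer D-0088(4), cell `bsd-littype`, seat 11, gen 4; OPEN-QUESTIONS-11 rows Q-J1 / Q-J2)

Sprung, J. Number Theory **132** (2012), p. 1504 (printed after Thm. 7.14, held text
`paper:doi-10-1016-j-jnt-2011-11-003` p0022 L37–L38), verbatim: "A consequence of Conjecture 6.15
would then be the following conjecture. **Conjecture 7.15.** Both `X♯(E/K_∞)` and `X♭(E/K_∞)` are
`Λ`-torsion." (Thm. 7.14: `X^∗` is torsion for the colour `∗` with `L^∗ ≠ 0`; = Sprung, J. reine
angew. Math. 681 (2013), Conj. 7.) This file proves that printed implication on the tree's REAL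
objects, at the trivial tame character (the `ℚ_∞`-objects): granted the conjecture leaf
`SprungChromaticNonvanishing` (p481108; OPEN, displayed as a hypothesis `h`) and Sprung's Theorem
7.14 as the named fact `Sprung2012.thm714_sharpFlatSelmerDual_finite_torsion` (p471329; a THEOREM of
the source, PUB, taken by name as `h714`), EVERY dual datum of `Sel^•(E/ℚ_∞)` for EVERY colour `•`
(`Sprung2012.SharpFlatSelmerDualData`, the object of bsd-ssimc p469334) is finitely generated and
`Λ`-torsion — Conj. 7.15 at `η = 1` (`sharpFlatSelmerDual_finite_isTorsion`). Likewise the Kato-side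
inclusion of Thm. 7.16 (`Sprung2012.thm716_sharpFlatCharIdeal_divisibility`, `h716`) then holds for
BOTH colours: `pⁿ L^• ∈ Char X^•` (`exists_pow_mul_chromaticL_mem_charIdeal`), `n = 0` under
`GL₂(ℤ_p)`-surjectivity (`chromaticL_mem_charIdeal_of_surjective`). No separate leaf is filed for
Conj. 7.15: by this file it is the conjunction «Conj. 6.15 ∧ Thm. 7.14» at `η = 1`, and a planner who
wants it as a premise names `SprungChromaticNonvanishing` (the `η ≠ 1` components are not tree
objects). THEOREMS ONLY; closes nothing; the leaf stays OPEN (its open content is `r_an(E) ≥ 1`,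
`sprungChromaticNonvanishing_iff_posAnalyticRank`). HONEST FRAMING (cell): typed ≠ proved ≠ endorsed.

References: [Sprung2012] Conj. 6.15 (p. 1498), Thm. 7.14, Conj. 7.15, Thm. 7.16 (p. 1504);
[Sprung2017] Conj. 4.12. HOME `run/shared/lean/pub/bsd-littype/` (OPEN-QUESTIONS-11 §D).
-/

set_option autoImplicit false

noncomputable section

open scoped Classical NumberField MatrixGroups ModularForm

open NumberField IsDedekindDomain WeierstrassCurve CongruenceSubgroup
  Literature.NumberTheory.EllipticCurves Literature.NumberTheory.EllipticCurves.ModularForms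
  Literature.NumberTheory.EllipticCurves.ZpExtension Literature.NumberTheory.EllipticCurves.Sprung2017
  Literature.NumberTheory.EllipticCurves.Sprung2012
  Literature.NumberTheory.EllipticCurves.Rank1Residual

namespace Summit.BirchSwinnertonDyer.Rank1Residual.Supersingular

namespace SprungChromaticNonvanishing

variable {W : WeierstrassCurve ℚ} [W.IsElliptic] [W.IsGloballyMinimal] {p : ℕ} [Fact p.Prime]
  {N : ℕ} [NeZero N] {f : CuspForm (Gamma0 N) 2}
  {κ : ZpExtension ℚ p} {γ : Field.absoluteGaloisGroup ℚ} {v : HeightOneSpectrum (𝓞 ℚ)}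
  {g : Field.absoluteGaloisGroup (v.adicCompletion ℚ)}
  {cneg : localPoints W (v.adicCompletion ℚ)} {c : ℕ → localPoints W (v.adicCompletion ℚ)}
  {Lsharp Lflat : IwasawaAlgebra p}

/-- **«Conj. 6.15 ⇒ Conj. 7.15» (Sprung 2012, p. 1504), `η = 1`, kernel-checked through Thm. 7.14.**
Granted the leaf `SprungChromaticNonvanishing` (`h`) and Thm. 7.14 as the named fact `h714`: at an odd
good supersingular `p`, for the newform `f` of `E`, cyclotomic `(κ, γ)` with the cyclotomic variable,
a place `v ∣ p` with local lift `g` and Honda system `(cneg, c)`, a Sprung pair `(L♯, L♭)`, EVERY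
colour `•` and EVERY dual datum `D` of `Sel^•(E/ℚ_∞)`: `D.X` is finitely generated and `Λ`-torsion
(both `X♯` and `X♭` cotorsion). [cite: Sprung2012, Conj. 7.15 and Thm. 7.14 (p. 1504)] -/
theorem sharpFlatSelmerDual_finite_isTorsion (h : SprungChromaticNonvanishing)
    (h714 : thm714_sharpFlatSelmerDual_finite_torsion) (hp : p ≠ 2) (hG : GoodSS W p)
    (hf : IsNewformOf W f) (hκ : κ.IsCyclotomic) (hγ : κ.IsTopGenerator γ)
    (hγ' : IsCyclotomicVariable p γ) (hv : (p : 𝓞 ℚ) ∈ v.asIdeal)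
    (hg : κ.IsTopGenerator (resGalOfEmb (closureEmb (K := ℚ) (v.adicCompletion ℚ)) g))
    (hH : IsHondaSystem κ (closureEmb (K := ℚ) (v.adicCompletion ℚ)) W (W.frobeniusTrace p) g cneg c)
    (hL : IsSprungPair f p (W.frobeniusTrace p) Lsharp Lflat) (col : Chroma)
    (D : SharpFlatSelmerDualData W κ γ (closureEmb (K := ℚ) (v.adicCompletion ℚ))
      (W.frobeniusTrace p) g c col) :
    Module.Finite (IwasawaAlgebra p) D.X ∧ Module.IsTorsion (IwasawaAlgebra p) D.X :=
  h714 W p hp hG.1 hG.2 f hf κ γ hκ hγ hγ' v hv g hg cneg c hH col Lsharp Lflat hL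
    (h.chromaticL_ne_zero hp hG hf hL col) D

/-- **Thm. 7.16 for BOTH colours, granted the leaf**: `pⁿ · L^• ∈ Char X^•(E/ℚ_∞)` for some `n ≥ 0`,
for every colour `•` (the fact `h716` is printed for "`∗` so that `L^∗ ≠ 0`"; the leaf supplies that
for both). [cite: Sprung2012, Thm. 7.16 (p. 1504) and Conj. 6.15 (p. 1498)] -/
theorem exists_pow_mul_chromaticL_mem_charIdeal (h : SprungChromaticNonvanishing)
    (h714 : thm714_sharpFlatSelmerDual_finite_torsion) (h716 : thm716_sharpFlatCharIdeal_divisibility)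
    (hp : p ≠ 2) (hG : GoodSS W p) (hf : IsNewformOf W f) (hκ : κ.IsCyclotomic)
    (hγ : κ.IsTopGenerator γ) (hγ' : IsCyclotomicVariable p γ) (hv : (p : 𝓞 ℚ) ∈ v.asIdeal)
    (hg : κ.IsTopGenerator (resGalOfEmb (closureEmb (K := ℚ) (v.adicCompletion ℚ)) g))
    (hH : IsHondaSystem κ (closureEmb (K := ℚ) (v.adicCompletion ℚ)) W (W.frobeniusTrace p) g cneg c)
    (hL : IsSprungPair f p (W.frobeniusTrace p) Lsharp Lflat) (col : Chroma)
    (D : SharpFlatSelmerDualData W κ γ (closureEmb (K := ℚ) (v.adicCompletion ℚ))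
      (W.frobeniusTrace p) g c col) :
    ∃ n : ℕ, (p : IwasawaAlgebra p) ^ n * chromaticL col Lsharp Lflat ∈ D.charIdeal := by
  have hL0 := h.chromaticL_ne_zero hp hG hf hL col
  obtain ⟨hfin, htors⟩ := h714 W p hp hG.1 hG.2 f hf κ γ hκ hγ hγ' v hv g hg cneg c hH col Lsharp Lflat
    hL hL0 D
  haveI := hfin
  exact (h716 W p hp hG.1 hG.2 f hf κ γ hκ hγ hγ' v hv g hg cneg c hH col Lsharp Lflat hL hL0 D htors).1

/-- **Thm. 1.4 for BOTH colours, granted the leaf**: if `ρ_{E,p^m}` is surjective for every `m`, then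
`L^• ∈ Char X^•(E/ℚ_∞)` for every colour `•`.
[cite: Sprung2012, Thm. 1.4 (p. 1486), Thm. 7.16 (p. 1504) and Conj. 6.15 (p. 1498)] -/
theorem chromaticL_mem_charIdeal_of_surjective (h : SprungChromaticNonvanishing)
    (h714 : thm714_sharpFlatSelmerDual_finite_torsion) (h716 : thm716_sharpFlatCharIdeal_divisibility)
    (hp : p ≠ 2) (hG : GoodSS W p) (hf : IsNewformOf W f) (hκ : κ.IsCyclotomic)
    (hγ : κ.IsTopGenerator γ) (hγ' : IsCyclotomicVariable p γ) (hv : (p : 𝓞 ℚ) ∈ v.asIdeal)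
    (hg : κ.IsTopGenerator (resGalOfEmb (closureEmb (K := ℚ) (v.adicCompletion ℚ)) g))
    (hH : IsHondaSystem κ (closureEmb (K := ℚ) (v.adicCompletion ℚ)) W (W.frobeniusTrace p) g cneg c)
    (hL : IsSprungPair f p (W.frobeniusTrace p) Lsharp Lflat)
    (hsurj : ∀ m : ℕ, W.HasSurjectiveModNGaloisRep (p ^ m : ℕ)) (col : Chroma)
    (D : SharpFlatSelmerDualData W κ γ (closureEmb (K := ℚ) (v.adicCompletion ℚ))
      (W.frobeniusTrace p) g c col) :
    chromaticL col Lsharp Lflat ∈ D.charIdeal := by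
  have hL0 := h.chromaticL_ne_zero hp hG hf hL col
  obtain ⟨hfin, htors⟩ := h714 W p hp hG.1 hG.2 f hf κ γ hκ hγ hγ' v hv g hg cneg c hH col Lsharp Lflat
    hL hL0 D
  haveI := hfin
  exact (h716 W p hp hG.1 hG.2 f hf κ γ hκ hγ hγ' v hv g hg cneg c hH col Lsharp Lflat hL hL0 D htors).2
    hsurj

end SprungChromaticNonvanishing

end Summit.BirchSwinnertonDyer.Rank1Residual.Supersingular

end
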